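/-
Copyright: the b2b-balaban T⁴-continuum CRUX team, row NE7b leaf lineage `t4-ne7b-formalise-leaf-05` (gen 160). Project licence.
-/
import Summits.QuantumFields.BalabanUV.T4Continuum.Spine.NE7b.BlockAverageEffectiveCeiling
import Summits.QuantumFields.BalabanUV.T4Continuum.Spine.NE7b.BlockAverageInterpolant
import Literature.MathematicalPhysics.QuantumFieldTheory.Balaban1983to89.B5Ineq167UpperZd

/-!
# PRINT's (1.67), RIGHT HALF, FOR THE SCALAR HARD FLOW ON THE TORUS: the effective form of the `η^d`-weighted fine Dirichlet form under
# print's block average `Q′_n` — `Q.bilinearComp H H`, `H` the critical section of `…BlockAverageCriticalSection` — obeys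
# `(Q.bilinearComp H H) g g ≤ γ₁(d)·⟨∂₁g, ∂₁g⟩` with `γ₁(d) = 2 + 8d²·36^d = Literature.….B5Ineq167UpperZd.gamma1 d` BY NAME, for EVERY
# side `n ≥ 1` (every composite level `L^k`), every torus and every `g`; with `…BlockAverageDirichletDomination`'s lower half (`γ₀ = 1`)
# this is (1.67) «`γ₀⟨∂₁B,∂₁B⟩ ≤ ⟨B, Δ_kB⟩ ≤ γ₁⟨∂₁B,∂₁B⟩`» in full for the scalar torus flow — the competitor is `…BlockAverageInterpolant`'s
# box-smoothed interpolant plus `…BlockAverageEffectiveCeiling`'s bump section on the defect of its block means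
# (row NE7b, node U5c; [folklore] over the tree's kernel theorems BY NAME — the last free-flow letter PRICING-NE7b v133 F791 lists NOT HERE)

Cell `pub-balaban`, sub-cell `t4`, spine estimate NE7b (`T4WeightBudget.RelWeightBound`; the cell's OWN estimate — NOT PRINTED in
[Bałaban 1983–89], NOT PROVED).  Crux-route work under `Spine/NE7b/` by a row leaf (`t4-ne7b-formalise-leaf-05` gen 160) under FREEZE (0)'s
crux-prover clause; the sixth file of this lineage's hard-flow packet.  NOTHING of Bałaban's is asserted beyond the tree's typed (1.20) block
average `B5Block118.QsOp` and (1.21)∕(1.4) Dirichlet matrices: the inputs are BAIP (`dirichlet_boxAvg_blockConst_le`,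
`nsq_QsOp_boxAvg_blockConst_sub_le`), BAEC (`exists_bumpSection`, `exists_interacting_criticalSection`), NE2's `…ScalarAveragedPropagator.nsq_GradOp_mulVec`, HSMO
(`transported_le_of_dominated`), BACS (`exists_criticalSection`,
`critical_le_transported`, `fineForm_symm ∕ _nonneg`), BADD (`dot_transpose_mul_self`, `sum_sq_reM_mulVec`, `coarse_form_eq`,
`transported_dominates_of_section`), (37) `…MatrixFormJunction.exists_map`, and the CONSTANT `B5Ineq167UpperZd.gamma1` (the tree's `ℤ^d`
theorem's `γ₁(d)`, imported for the by-name concordance only).  No `T4Continuum/Support` leaf typed; no `def`; zero `sorry`.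

WHY.  A ceiling against `‖g‖²` (BAEC) cannot be print's: (1.67) compares `Δ_k` with the unit Laplacian, constants going to constants.  As on
`ℤ^d`, test the least-energy property of the critical section (BACS `critical_le_transported`) against a section of `Q′_n` whose
`η`-energy is controlled by `⟨∂₁g, ∂₁g⟩`: `T g := A₁g + T_b(g − Q′_nA₁g)` with `A₁` BAIP's interpolant (energy `≤ R g g`, block-mean defect
`‖g − Q′A₁g‖² ≤ d·R g g`) and `T_b` BAEC's bump section (`Q′T_b = 1`, energy `≤ 4d·36^d·‖·‖²`); then `Q′(Tg) = Q′A₁g + (g − Q′A₁g) = g` and, `Q`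
being a nonnegative symmetric form, `Q (Tg)(Tg) ≤ 2Q(A₁g)(A₁g) + 2Q(T_b δ)(T_b δ) ≤ 2R g g + 2·4d·36^d·d·R g g = (2 + 8d²·36^d)·R g g` —
EXACTLY the tree's `γ₁(d)` on `ℤ^d` (same competitor, same bump constant `6` per direction).

WHAT IS PROVED ([folklore]; `n ≥ 1`, any torus `M`, any `d`; `E = EuclideanSpace ℝ (Tor (fine n M))`, `F = EuclideanSpace ℝ (Tor M)`; `hQ`, `hR`,
`hD` = BADD ∕ BAKF ∕ BACS ∕ BAEC's coordinate characterisations VERBATIM; the interpolant's matrix `A₁m = of (x y ↦ n^{−d}·#{j : blockOf(x + ιj) = y})`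
written out — no `def`):
* §1 `interpolantMatrix_mulVec`, `cplx_interpolantMatrix_mulVec` (`cplx (A₁m g) = boxAvg ψ_{cplx g}`), `sum_norm_sub_sq_eq_coarse_dot`,
  **`interpolant_dot_le`** (`(A₁m g) ⬝ (A (A₁m g)) ≤ g ⬝ (S g)` — constant ONE), **`interpolant_defect_dot_le`** (`δ ⬝ δ ≤ d·(g ⬝ S g)`,
  `δ = g − reM Q′_n (A₁m g)`).
* §2 **`exists_interpolantSection`** (`∃ T_A : F →L E`, `Q (T_A g)(T_A g) ≤ R g g`, `‖g − D (T_A g)‖² ≤ d·R g g`), `quad_add_le`,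
  **`exists_competitorSection`** (`∃ T`, `D (T g) = g`, `Q (T g)(T g) ≤ gamma1 d · R g g`).
* §3 **`critical_le_gamma1`** (ANY critical section `H` of `D` for `Q`: `(Q.bilinearComp H H) g g ≤ gamma1 d · R g g`),
  **`exists_criticalSection_ineq167`** (`∃ H` critical with `R g g ≤ (Q.bilinearComp H H) g g ≤ gamma1 d · R g g` for all `g` — (1.67) in full,
  `γ₀ = 1`, `γ₁ = γ₁(d)`, level-free, volume-free).
* §4 **`interacting_ineq167_of_sandwich`** (ANY symmetric form `V` with `γ₀·Q ≤ V ≤ γ₁·Q` on `E`, `0 ≤ γ₀`, `0 ≤ γ₁`, along a `V`-critical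
  section `T` of `D`: `γ₀·R g g ≤ (V.bilinearComp T T) g g ≤ γ₁·gamma1 d·R g g` — the interacting hard step inherits (1.67) with letters
  `(γ₀, γ₁·γ₁(d))`, via BADD's lower half and HSMO `transported_le_of_dominated` against §2's competitor), **`exists_interacting_ineq167`**
  (`0 < γ₀` ⟹ such a `T` EXISTS, BAEC `exists_interacting_criticalSection`, and carries both letters).
* §5 toy: `gamma1 4 = 214 990 850`.

NOT HERE (honest): a good `γ₁` (by value as useless as on `ℤ^d`; the tree's sharp `ℤ^d` constant `(π²∕4)^{d+1}` of `B5Ineq167SharpUpperZd` is a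
FOURIER statement with no torus twin here); the identification of `Q.bilinearComp H H` with a periodisation of print's `Δ_k` (the OWNER's (55));
the VECTOR torus operator (in the tree: `B5Eq166GaussDeltaK.ineq167_DeltaK_sharp`); `ℓ²(ℤ^d)`; covariant `U ≠ 1`; anything of Bałaban's
small-field action ((A3) ∕ (A1c), NC-NE7b-α UNRULED).  BY-NAME EFFECT ON THE WALL: NONE (the free scalar flow's reference letters on print's
torus are now complete in both currencies; the wall is (R2)).  NE7b NOT PRINTED ∕ NOT PROVED; spine PROVED 0∕9; rung (B)+1 on a FINITE torus —
NOT infinite volume, NOT the mass gap, NOT Clay.  HONEST DEPENDENCY: continuum YM on T⁴ ⇐ BetaPertH ∧ nine spine estimates (0∕9 proved);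
BetaPertH ⇐ (D1) ∧ (D4) ∧ CAP+tail; G-an2-4 gates asym, D1 and NE2∕3∕4.
-/

set_option autoImplicit false

namespace Summit.QuantumFields.BalabanUV.T4Continuum.NE7b.BlockAverageUpperBound

open Matrix WithLp Finset
open Literature.MathematicalPhysics.QuantumFieldTheory.Balaban1983to89
open B5Prop11Plancherel (Tor fine unitVec)
open B5Prop11Lower (nsq nsq_nonneg)
open B5Action121 (GradOp)
open B5Block118 (QsOp iota)
open B5Blocks16 (blockOf)
open B5RealFields (IsReal reM cplx isReal_QsOp isReal_GradOp nsq_cplx)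
open B5Ineq167UpperZd (gamma1)
open Summit.QuantumFields.BalabanUV.T4Continuum.ScalarBlockPoincare (boxAvg nsq_sub_comm)
open Summit.QuantumFields.BalabanUV.T4Continuum.NE7b.MatrixFormJunction (exists_map)
open Summit.QuantumFields.BalabanUV.T4Continuum.NE7b.BlockAverageDirichletDomination
  (dot_transpose_mul_self sum_sq_reM_mulVec coarse_form_eq transported_dominates_of_section)
open Summit.QuantumFields.BalabanUV.T4Continuum.NE7b.BlockAverageCriticalSection
  (exists_criticalSection critical_le_transported fineForm_symm fineForm_nonneg)
open Summit.QuantumFields.BalabanUV.T4Continuum.NE7b.HardStepMonotone (transported_le_of_dominated)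
open Summit.QuantumFields.BalabanUV.T4Continuum.ScalarAveragedPropagator (nsq_GradOp_mulVec)
open Summit.QuantumFields.BalabanUV.T4Continuum.NE7b.BlockAverageEffectiveCeiling
  (exists_bumpSection exists_interacting_criticalSection)
open Summit.QuantumFields.BalabanUV.T4Continuum.NE7b.BlockAverageInterpolant
  (dirichlet_boxAvg_blockConst_le nsq_QsOp_boxAvg_blockConst_sub_le)

variable {d : ℕ} (n : ℕ) [NeZero n] (M : Fin d → ℕ) [hM : ∀ μ, NeZero (M μ)]

/-! ## §1. The interpolant section's matrix and its two letters in real `dotProduct` currency -/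

/-- `(A₁m g)(x) = n^{−d}·Σ_j g(blockOf (x + ιj))` for the interpolant matrix `A₁m = of (x y ↦ n^{−d}·#{j : blockOf(x + ιj) = y})`. [folklore] -/
theorem interpolantMatrix_mulVec (g : Tor M → ℝ) (x : Tor (fine n M)) :
    ((Matrix.of fun (x : Tor (fine n M)) (y : Tor M) =>
        ((n : ℝ) ^ d)⁻¹ * ∑ j : Fin d → Fin n, if blockOf n M (x + iota n M j) = y then (1 : ℝ) else 0) *ᵥ g) x
      = ((n : ℝ) ^ d)⁻¹ * ∑ j : Fin d → Fin n, g (blockOf n M (x + iota n M j)) := by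
  simp only [Matrix.mulVec, dotProduct, Matrix.of_apply, mul_assoc, Finset.sum_mul, ite_mul, one_mul, zero_mul]
  rw [← Finset.mul_sum, Finset.sum_comm]
  congr 1
  refine Finset.sum_congr rfl fun j _ => ?_
  rw [Finset.sum_ite_eq, if_pos (Finset.mem_univ _)]

/-- In complex clothes the interpolant matrix is the box-smoothed block-constant interpolant: `cplx (A₁m g) = boxAvg ψ_{cplx g}`. [folklore] -/
theorem cplx_interpolantMatrix_mulVec (g : Tor M → ℝ) :
    cplx ((Matrix.of fun (x : Tor (fine n M)) (y : Tor M) =>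
        ((n : ℝ) ^ d)⁻¹ * ∑ j : Fin d → Fin n, if blockOf n M (x + iota n M j) = y then (1 : ℝ) else 0) *ᵥ g)
      = boxAvg n M (fun x => cplx g (blockOf n M x)) := by
  funext x
  rw [B5RealFields.cplx_apply, interpolantMatrix_mulVec, boxAvg]
  simp only [Pi.smul_apply, Finset.sum_apply, ScalarBlockPoincare.transS, smul_eq_mul, B5RealFields.cplx_apply]
  push_cast
  rfl

omit [NeZero n] in
/-- `Σ_ν Σ_y ‖(g(y+e_ν) : ℂ) − g(y)‖² = g ⬝ (S g)` for the unit-lattice Dirichlet matrix `S` (BADD `coarse_form_eq`). [folklore] -/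
theorem sum_norm_sub_sq_eq_coarse_dot (g : Tor M → ℝ) :
    ∑ ν : Fin d, ∑ y : Tor M, ‖cplx g (y + unitVec M ν) - cplx g y‖ ^ 2
      = g ⬝ᵥ (((reM (GradOp M 1))ᵀ * reM (GradOp M 1)) *ᵥ g) := by
  rw [coarse_form_eq M g, Finset.sum_comm]
  refine Finset.sum_congr rfl fun y _ => Finset.sum_congr rfl fun ν _ => ?_
  rw [B5RealFields.cplx_apply, B5RealFields.cplx_apply, ← Complex.ofReal_sub, Complex.norm_real, Real.norm_eq_abs, sq_abs]

/-- **THE INTERPOLANT's ENERGY IN `dotProduct` CURRENCY**: `(A₁m g) ⬝ (A (A₁m g)) ≤ g ⬝ (S g)` — BADD's fine matrix `A = η^d(reM ∂^η)ᵀ(reM ∂^η)`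
against the unit-lattice Dirichlet matrix, constant ONE (BAIP `dirichlet_boxAvg_blockConst_le`). [folklore] -/
theorem interpolant_dot_le (g : Tor M → ℝ) :
    ((Matrix.of fun (x : Tor (fine n M)) (y : Tor M) =>
        ((n : ℝ) ^ d)⁻¹ * ∑ j : Fin d → Fin n, if blockOf n M (x + iota n M j) = y then (1 : ℝ) else 0) *ᵥ g) ⬝ᵥ
      (((1 / (n : ℝ) ^ d) • ((reM (GradOp (fine n M) (n : ℂ)))ᵀ * reM (GradOp (fine n M) (n : ℂ)))) *ᵥ
        ((Matrix.of fun (x : Tor (fine n M)) (y : Tor M) =>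
          ((n : ℝ) ^ d)⁻¹ * ∑ j : Fin d → Fin n, if blockOf n M (x + iota n M j) = y then (1 : ℝ) else 0) *ᵥ g))
      ≤ g ⬝ᵥ (((reM (GradOp M 1))ᵀ * reM (GradOp M 1)) *ᵥ g) := by
  have hn : (0 : ℝ) < (n : ℝ) ^ d := by
    have : (0 : ℝ) < n := by exact_mod_cast Nat.pos_of_ne_zero (NeZero.ne n)
    positivity
  have hnr : IsReal (GradOp (fine n M) (n : ℂ)) := isReal_GradOp (fine n M) (by simp)
  rw [Matrix.smul_mulVec, dotProduct_smul, smul_eq_mul, dot_transpose_mul_self, sum_sq_reM_mulVec hnr,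
    cplx_interpolantMatrix_mulVec, nsq_GradOp_mulVec, ← sum_norm_sub_sq_eq_coarse_dot]
  have h := dirichlet_boxAvg_blockConst_le n M (cplx g)
  calc 1 / (n : ℝ) ^ d * ScalarAveragedPropagator.dirichlet n M (boxAvg n M fun x => cplx g (blockOf n M x))
      ≤ 1 / (n : ℝ) ^ d * ((n : ℝ) ^ d * ∑ μ : Fin d, ∑ y : Tor M, ‖cplx g (y + unitVec M μ) - cplx g y‖ ^ 2) :=
        mul_le_mul_of_nonneg_left h (by positivity)
    _ = ∑ μ : Fin d, ∑ y : Tor M, ‖cplx g (y + unitVec M μ) - cplx g y‖ ^ 2 := by field_simp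

/-- **THE INTERPOLANT's DEFECT IN `dotProduct` CURRENCY**: `δ ⬝ δ ≤ d·(g ⬝ S g)` for `δ := g − reM Q′_n (A₁m g)` (BAIP `nsq_QsOp_boxAvg_blockConst_sub_le`). [folklore] -/
theorem interpolant_defect_dot_le (g : Tor M → ℝ) :
    (g - reM (QsOp n M) *ᵥ ((Matrix.of fun (x : Tor (fine n M)) (y : Tor M) =>
        ((n : ℝ) ^ d)⁻¹ * ∑ j : Fin d → Fin n, if blockOf n M (x + iota n M j) = y then (1 : ℝ) else 0) *ᵥ g)) ⬝ᵥ
      (g - reM (QsOp n M) *ᵥ ((Matrix.of fun (x : Tor (fine n M)) (y : Tor M) =>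
        ((n : ℝ) ^ d)⁻¹ * ∑ j : Fin d → Fin n, if blockOf n M (x + iota n M j) = y then (1 : ℝ) else 0) *ᵥ g))
      ≤ d * (g ⬝ᵥ (((reM (GradOp M 1))ᵀ * reM (GradOp M 1)) *ᵥ g)) := by
  set δ := g - reM (QsOp n M) *ᵥ ((Matrix.of fun (x : Tor (fine n M)) (y : Tor M) =>
        ((n : ℝ) ^ d)⁻¹ * ∑ j : Fin d → Fin n, if blockOf n M (x + iota n M j) = y then (1 : ℝ) else 0) *ᵥ g) with hδ
  have hdd : δ ⬝ᵥ δ = nsq (cplx δ) := by rw [nsq_cplx]; simp only [dotProduct, sq]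
  have hc : cplx δ = cplx g - QsOp n M *ᵥ boxAvg n M (fun x => cplx g (blockOf n M x)) := by
    rw [hδ, ← cplx_interpolantMatrix_mulVec, ← (isReal_QsOp n M).cplx_mulVec]
    funext y
    simp only [B5RealFields.cplx_apply, Pi.sub_apply, Complex.ofReal_sub]
  rw [hdd, hc, nsq_sub_comm, ← sum_norm_sub_sq_eq_coarse_dot]
  exact nsq_QsOp_boxAvg_blockConst_sub_le n M (cplx g)

/-! ## §2. The interpolant as a CLM; the competitor section and its energy `γ₁(d)·R g g` -/

/-- **THE INTERPOLANT AS A CLM WITH ITS TWO LETTERS**: for `Q`, `R`, `D` characterised by BADD's fine matrix, the unit-lattice Dirichlet matrix and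
`reM Q′_n` there is `T_A : F →L E` with `Q (T_A g)(T_A g) ≤ R g g` and `‖g − D (T_A g)‖² ≤ d·R g g`. [folklore] -/
theorem exists_interpolantSection
    {Q : EuclideanSpace ℝ (Tor (fine n M)) →L[ℝ] EuclideanSpace ℝ (Tor (fine n M)) →L[ℝ] ℝ}
    {R : EuclideanSpace ℝ (Tor M) →L[ℝ] EuclideanSpace ℝ (Tor M) →L[ℝ] ℝ}
    {D : EuclideanSpace ℝ (Tor (fine n M)) →L[ℝ] EuclideanSpace ℝ (Tor M)}
    (hQ : ∀ x y, Q x y = ofLp x ⬝ᵥ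
      (((1 / (n : ℝ) ^ d) • ((reM (GradOp (fine n M) (n : ℂ)))ᵀ * reM (GradOp (fine n M) (n : ℂ)))) *ᵥ ofLp y))
    (hR : ∀ g h, R g h = ofLp g ⬝ᵥ (((reM (GradOp M 1))ᵀ * reM (GradOp M 1)) *ᵥ ofLp h))
    (hD : ∀ x, ofLp (D x) = reM (QsOp n M) *ᵥ ofLp x) :
    ∃ TA : EuclideanSpace ℝ (Tor M) →L[ℝ] EuclideanSpace ℝ (Tor (fine n M)),
      (∀ g, Q (TA g) (TA g) ≤ R g g) ∧ (∀ g, ‖g - D (TA g)‖ ^ 2 ≤ d * R g g) := by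
  classical
  obtain ⟨TA, hTA⟩ := exists_map (ι := Tor M) (κ := Tor (fine n M))
    (Matrix.of fun (x : Tor (fine n M)) (y : Tor M) =>
      ((n : ℝ) ^ d)⁻¹ * ∑ j : Fin d → Fin n, if blockOf n M (x + iota n M j) = y then (1 : ℝ) else 0)
  refine ⟨TA, fun g => ?_, fun g => ?_⟩
  · rw [hQ, hTA, hR]
    exact interpolant_dot_le n M (ofLp g)
  · have hn : ‖g - D (TA g)‖ ^ 2 = ofLp (g - D (TA g)) ⬝ᵥ ofLp (g - D (TA g)) := by
      rw [EuclideanSpace.norm_sq_eq]; simp [dotProduct, sq]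
    rw [hn, WithLp.ofLp_sub, hD, hTA, hR]
    exact interpolant_defect_dot_le n M (ofLp g)

omit hM in
/-- A nonnegative symmetric form satisfies `Q (a + b)(a + b) ≤ 2·Q a a + 2·Q b b`. [folklore] -/
theorem quad_add_le {E : Type*} [NormedAddCommGroup E] [NormedSpace ℝ E] (Q : E →L[ℝ] E →L[ℝ] ℝ)
    (hsymm : ∀ x y, Q x y = Q y x) (hpos : ∀ x, 0 ≤ Q x x) (a b : E) : Q (a + b) (a + b) ≤ 2 * Q a a + 2 * Q b b := by
  have h := hpos (a - b)
  simp only [map_add, map_sub, _root_.add_apply, _root_.sub_apply] at h ⊢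
  rw [hsymm b a] at h ⊢
  linarith

/-- **THE COMPETITOR SECTION**: `T := T_A + T_b ∘ (1 − D ∘ T_A)` (`T_b` = BAEC's bump section) is a continuous right inverse of `D` with
`Q (T g)(T g) ≤ (2 + 8d²·36^d)·R g g = γ₁(d)·R g g`, `γ₁ = B5Ineq167UpperZd.gamma1` BY NAME — the torus twin of
`B5Ineq167UpperZd.energy_competitor_le`. [folklore] -/
theorem exists_competitorSection
    {Q : EuclideanSpace ℝ (Tor (fine n M)) →L[ℝ] EuclideanSpace ℝ (Tor (fine n M)) →L[ℝ] ℝ}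
    {R : EuclideanSpace ℝ (Tor M) →L[ℝ] EuclideanSpace ℝ (Tor M) →L[ℝ] ℝ}
    {D : EuclideanSpace ℝ (Tor (fine n M)) →L[ℝ] EuclideanSpace ℝ (Tor M)}
    (hQ : ∀ x y, Q x y = ofLp x ⬝ᵥ
      (((1 / (n : ℝ) ^ d) • ((reM (GradOp (fine n M) (n : ℂ)))ᵀ * reM (GradOp (fine n M) (n : ℂ)))) *ᵥ ofLp y))
    (hR : ∀ g h, R g h = ofLp g ⬝ᵥ (((reM (GradOp M 1))ᵀ * reM (GradOp M 1)) *ᵥ ofLp h))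
    (hD : ∀ x, ofLp (D x) = reM (QsOp n M) *ᵥ ofLp x) :
    ∃ T : EuclideanSpace ℝ (Tor M) →L[ℝ] EuclideanSpace ℝ (Tor (fine n M)),
      (∀ g, D (T g) = g) ∧ (∀ g, Q (T g) (T g) ≤ gamma1 d * R g g) := by
  obtain ⟨TA, hAe, hAd⟩ := exists_interpolantSection n M hQ hR hD
  obtain ⟨Tb, -, hTb, hTbc⟩ := exists_bumpSection n M hQ hD
  refine ⟨TA + Tb.comp (ContinuousLinearMap.id ℝ _ - D.comp TA), fun g => ?_, fun g => ?_⟩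
  · simp only [_root_.add_apply, ContinuousLinearMap.comp_apply, _root_.sub_apply,
      ContinuousLinearMap.id_apply, map_add, hTb, add_sub_cancel]
  · have hR0 : 0 ≤ R g g := by
      rw [hR, dot_transpose_mul_self]; exact Finset.sum_nonneg fun i _ => sq_nonneg _
    have h1 := quad_add_le Q (fineForm_symm n M hQ) (fineForm_nonneg n M hQ) (TA g) (Tb (g - D (TA g)))
    have h2 : Q (Tb (g - D (TA g))) (Tb (g - D (TA g))) ≤ 4 * d * (36 : ℝ) ^ d * (d * R g g) :=
      (hTbc _).trans (mul_le_mul_of_nonneg_left (hAd g) (by positivity))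
    simp only [_root_.add_apply, ContinuousLinearMap.comp_apply, _root_.sub_apply,
      ContinuousLinearMap.id_apply]
    calc Q (TA g + Tb (g - D (TA g))) (TA g + Tb (g - D (TA g)))
        ≤ 2 * Q (TA g) (TA g) + 2 * Q (Tb (g - D (TA g))) (Tb (g - D (TA g))) := h1
      _ ≤ 2 * R g g + 2 * (4 * d * (36 : ℝ) ^ d * (d * R g g)) := by linarith [hAe g, h2]
      _ = gamma1 d * R g g := by rw [gamma1]; ring

/-! ## §3. Print's (1.67), right half, for the scalar hard flow on the torus: `⟨g, Δ_eff g⟩ ≤ γ₁(d)·⟨∂₁g, ∂₁g⟩` -/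

/-- **(1.67), RIGHT HALF, SCALAR TORUS FLOW**: for `Q`, `R`, `D` characterised by BADD's fine matrix, the unit-lattice Dirichlet matrix and
`reM Q′_n` (ANY side `n ≥ 1` — every composite level `L^k` — every torus) and ANY critical section `H` of `D`:
`(Q.bilinearComp H H) g g ≤ γ₁(d)·R g g` with `γ₁(d) = 2 + 8d²·36^d = B5Ineq167UpperZd.gamma1 d` — least energy (BACS) against the competitor. [folklore] -/
theorem critical_le_gamma1
    {Q : EuclideanSpace ℝ (Tor (fine n M)) →L[ℝ] EuclideanSpace ℝ (Tor (fine n M)) →L[ℝ] ℝ}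
    {R : EuclideanSpace ℝ (Tor M) →L[ℝ] EuclideanSpace ℝ (Tor M) →L[ℝ] ℝ}
    {D : EuclideanSpace ℝ (Tor (fine n M)) →L[ℝ] EuclideanSpace ℝ (Tor M)}
    (hQ : ∀ x y, Q x y = ofLp x ⬝ᵥ
      (((1 / (n : ℝ) ^ d) • ((reM (GradOp (fine n M) (n : ℂ)))ᵀ * reM (GradOp (fine n M) (n : ℂ)))) *ᵥ ofLp y))
    (hR : ∀ g h, R g h = ofLp g ⬝ᵥ (((reM (GradOp M 1))ᵀ * reM (GradOp M 1)) *ᵥ ofLp h))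
    (hD : ∀ x, ofLp (D x) = reM (QsOp n M) *ᵥ ofLp x)
    {H : EuclideanSpace ℝ (Tor M) →L[ℝ] EuclideanSpace ℝ (Tor (fine n M))}
    (hH : ∀ g, D (H g) = g) (hHo : ∀ g κ, D κ = 0 → Q (H g) κ = 0) (g : EuclideanSpace ℝ (Tor M)) :
    (Q.bilinearComp H H) g g ≤ gamma1 d * R g g := by
  obtain ⟨T, hT, hTc⟩ := exists_competitorSection n M hQ hR hD
  calc (Q.bilinearComp H H) g g ≤ (Q.bilinearComp T T) g g := critical_le_transported n M hQ hH hHo hT g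
    _ = Q (T g) (T g) := by rw [ContinuousLinearMap.bilinearComp_apply]
    _ ≤ gamma1 d * R g g := hTc g

/-- **(1.67) IN FULL FOR THE SCALAR HARD FLOW ON PRINT's TORUS**: the critical section `H` of `Q′_n` EXISTS (BACS) and the effective form
`Q.bilinearComp H H` is sandwiched `R g g ≤ (Q.bilinearComp H H) g g ≤ γ₁(d)·R g g` — `γ₀ = 1` (BADD `transported_dominates_of_section`),
`γ₁ = B5Ineq167UpperZd.gamma1 d` — for every side `n`, every torus `M`, every `g`. [folklore] -/
theorem exists_criticalSection_ineq167
    {Q : EuclideanSpace ℝ (Tor (fine n M)) →L[ℝ] EuclideanSpace ℝ (Tor (fine n M)) →L[ℝ] ℝ}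
    {R : EuclideanSpace ℝ (Tor M) →L[ℝ] EuclideanSpace ℝ (Tor M) →L[ℝ] ℝ}
    {D : EuclideanSpace ℝ (Tor (fine n M)) →L[ℝ] EuclideanSpace ℝ (Tor M)}
    (hQ : ∀ x y, Q x y = ofLp x ⬝ᵥ
      (((1 / (n : ℝ) ^ d) • ((reM (GradOp (fine n M) (n : ℂ)))ᵀ * reM (GradOp (fine n M) (n : ℂ)))) *ᵥ ofLp y))
    (hR : ∀ g h, R g h = ofLp g ⬝ᵥ (((reM (GradOp M 1))ᵀ * reM (GradOp M 1)) *ᵥ ofLp h))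
    (hD : ∀ x, ofLp (D x) = reM (QsOp n M) *ᵥ ofLp x) :
    ∃ H : EuclideanSpace ℝ (Tor M) →L[ℝ] EuclideanSpace ℝ (Tor (fine n M)),
      (∀ g, D (H g) = g) ∧ (∀ g κ, D κ = 0 → Q (H g) κ = 0) ∧
      (∀ g, R g g ≤ (Q.bilinearComp H H) g g ∧ (Q.bilinearComp H H) g g ≤ gamma1 d * R g g) := by
  obtain ⟨H, hH, hHo⟩ := exists_criticalSection n M hQ hD
  exact ⟨H, hH, hHo, fun g => ⟨transported_dominates_of_section n M hQ hR hD hH g, critical_le_gamma1 n M hQ hR hD hH hHo g⟩⟩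

/-! ## §4. The interacting hard step inherits (1.67): `γ₀·Q ≤ V ≤ γ₁·Q` ⟹ `γ₀·R ≤ V⁺ ≤ γ₁·γ₁(d)·R` along `V`'s critical section -/

/-- **THE INTERACTING (1.67).**  `V` ANY symmetric continuous bilinear form on `E` sandwiched by the free fine form,
`γ₀·Q v v ≤ V v v ≤ γ₁·Q v v` (`0 ≤ γ₀`, `0 ≤ γ₁`); `T` a `V`-critical section of `D` (`D (T g) = g`, `V (T g) κ = 0` on `ker D`).  Then the
effective interacting form along `T` obeys print's (1.67) with letters `(γ₀, γ₁·γ₁(d))`: the lower half is BADD's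
`transported_dominates_of_section` (valid along ANY section) times `γ₀`; the upper half is HSMO's `transported_le_of_dominated` (least
`V`-energy of the critical section against §2's competitor section `T_c`, `Q (T_c g)(T_c g) ≤ γ₁(d)·R g g`) times `γ₁`. [folklore] -/
theorem interacting_ineq167_of_sandwich
    {Q : EuclideanSpace ℝ (Tor (fine n M)) →L[ℝ] EuclideanSpace ℝ (Tor (fine n M)) →L[ℝ] ℝ}
    {R : EuclideanSpace ℝ (Tor M) →L[ℝ] EuclideanSpace ℝ (Tor M) →L[ℝ] ℝ}
    {D : EuclideanSpace ℝ (Tor (fine n M)) →L[ℝ] EuclideanSpace ℝ (Tor M)}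
    (hQ : ∀ x y, Q x y = ofLp x ⬝ᵥ
      (((1 / (n : ℝ) ^ d) • ((reM (GradOp (fine n M) (n : ℂ)))ᵀ * reM (GradOp (fine n M) (n : ℂ)))) *ᵥ ofLp y))
    (hR : ∀ g h, R g h = ofLp g ⬝ᵥ (((reM (GradOp M 1))ᵀ * reM (GradOp M 1)) *ᵥ ofLp h))
    (hD : ∀ x, ofLp (D x) = reM (QsOp n M) *ᵥ ofLp x)
    {V : EuclideanSpace ℝ (Tor (fine n M)) →L[ℝ] EuclideanSpace ℝ (Tor (fine n M)) →L[ℝ] ℝ}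
    (hVsymm : ∀ u v, V u v = V v u) {γ₀ γ₁ : ℝ} (hγ₀ : 0 ≤ γ₀) (hγ₁ : 0 ≤ γ₁)
    (hlo : ∀ v, γ₀ * Q v v ≤ V v v) (hhi : ∀ v, V v v ≤ γ₁ * Q v v)
    {T : EuclideanSpace ℝ (Tor M) →L[ℝ] EuclideanSpace ℝ (Tor (fine n M))}
    (hT : ∀ g, D (T g) = g) (hTorth : ∀ g κ, D κ = 0 → V (T g) κ = 0) (g : EuclideanSpace ℝ (Tor M)) :
    γ₀ * R g g ≤ (V.bilinearComp T T) g g ∧ (V.bilinearComp T T) g g ≤ γ₁ * gamma1 d * R g g := by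
  obtain ⟨Tc, hTc, hTcc⟩ := exists_competitorSection n M hQ hR hD
  have hVpos : ∀ κ, D κ = 0 → 0 ≤ V κ κ := fun κ _ =>
    (mul_nonneg hγ₀ (fineForm_nonneg n M hQ κ)).trans (hlo κ)
  refine ⟨?_, ?_⟩
  · calc γ₀ * R g g ≤ γ₀ * (Q.bilinearComp T T) g g :=
          mul_le_mul_of_nonneg_left (transported_dominates_of_section n M hQ hR hD hT g) hγ₀
      _ = γ₀ * Q (T g) (T g) := by rw [ContinuousLinearMap.bilinearComp_apply]
      _ ≤ V (T g) (T g) := hlo (T g)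
      _ = (V.bilinearComp T T) g g := by rw [ContinuousLinearMap.bilinearComp_apply]
  · calc (V.bilinearComp T T) g g ≤ γ₁ * (Q.bilinearComp Tc Tc) g g :=
          transported_le_of_dominated V Q D T Tc hT hTc hTorth hVsymm hVpos hhi g
      _ = γ₁ * Q (Tc g) (Tc g) := by rw [ContinuousLinearMap.bilinearComp_apply]
      _ ≤ γ₁ * (gamma1 d * R g g) := mul_le_mul_of_nonneg_left (hTcc g) hγ₁
      _ = γ₁ * gamma1 d * R g g := by ring

/-- **THE INTERACTING (1.67), SELF-CONTAINED**: `V` symmetric with `γ₀·Q ≤ V ≤ γ₁·Q` on `E` and `0 < γ₀` ⟹ THERE IS a `V`-critical section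
`T` of `D` (BAEC `exists_interacting_criticalSection`) and along it `γ₀·R g g ≤ (V.bilinearComp T T) g g ≤ γ₁·γ₁(d)·R g g` for every `g`
— no section hypothesis left. [folklore] -/
theorem exists_interacting_ineq167
    {Q : EuclideanSpace ℝ (Tor (fine n M)) →L[ℝ] EuclideanSpace ℝ (Tor (fine n M)) →L[ℝ] ℝ}
    {R : EuclideanSpace ℝ (Tor M) →L[ℝ] EuclideanSpace ℝ (Tor M) →L[ℝ] ℝ}
    {D : EuclideanSpace ℝ (Tor (fine n M)) →L[ℝ] EuclideanSpace ℝ (Tor M)}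
    (hQ : ∀ x y, Q x y = ofLp x ⬝ᵥ
      (((1 / (n : ℝ) ^ d) • ((reM (GradOp (fine n M) (n : ℂ)))ᵀ * reM (GradOp (fine n M) (n : ℂ)))) *ᵥ ofLp y))
    (hR : ∀ g h, R g h = ofLp g ⬝ᵥ (((reM (GradOp M 1))ᵀ * reM (GradOp M 1)) *ᵥ ofLp h))
    (hD : ∀ x, ofLp (D x) = reM (QsOp n M) *ᵥ ofLp x)
    {V : EuclideanSpace ℝ (Tor (fine n M)) →L[ℝ] EuclideanSpace ℝ (Tor (fine n M)) →L[ℝ] ℝ}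
    (hVsymm : ∀ u v, V u v = V v u) {γ₀ γ₁ : ℝ} (hγ₀ : 0 < γ₀) (hγ₁ : 0 ≤ γ₁)
    (hlo : ∀ v, γ₀ * Q v v ≤ V v v) (hhi : ∀ v, V v v ≤ γ₁ * Q v v) :
    ∃ T : EuclideanSpace ℝ (Tor M) →L[ℝ] EuclideanSpace ℝ (Tor (fine n M)),
      (∀ g, D (T g) = g) ∧ (∀ g κ, D κ = 0 → V (T g) κ = 0) ∧
      (∀ g, γ₀ * R g g ≤ (V.bilinearComp T T) g g ∧ (V.bilinearComp T T) g g ≤ γ₁ * gamma1 d * R g g) := by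
  obtain ⟨T, hT, hTo⟩ := exists_interacting_criticalSection n M hQ hD hγ₀ hlo
  exact ⟨T, hT, hTo, fun g => interacting_ineq167_of_sandwich n M hQ hR hD hVsymm hγ₀.le hγ₁ hlo hhi hT hTo g⟩

/-! ## §5. Toy -/

/-- Toy: `γ₁(4) = 2 + 8·16·36⁴ = 214990850` — by value as useless as on `ℤ^d`; the point is the shape `γ₁(d)·⟨∂₁g, ∂₁g⟩`, level-free. -/
example : gamma1 4 = 214990850 := by rw [gamma1]; norm_num

end Summit.QuantumFields.BalabanUV.T4Continuum.NE7b.BlockAverageUpperBound
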